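import Summits.ValiantsHypothesis.ValiantsHypothesis.Theorems.DefinabilityGapZperTransfer
import HarnessLib

/-!
# DefinabilityGap — the `Z(per)` transfer repaired: FULL width 2 from the READ-ONCE leaf `ZperHitsRO(m)`

Route `route-ValiantsHypothesis-DefinabilityGap`, read-once leaf F4 / W10 (`KIPlantedHittingRO`,
stmt-ValiantsHypothesis-23704).
The leaf of record `ZperHits₂(m)` of `DefinabilityGapZperTransfer.chainVal_eq_zero_of_bind₁_kiPer` is false for every
`m` (`DefinabilityGapZperVoid.not_zperHits_two`: the Saha–Saptharishi–Saxena void). The defect is OVER-QUANTIFICATION,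
not the mechanism: the induction of the transfer consumes its leaf only on the PUSHED CHART CHAINS `pushLinks m c rest`
of read-once block suffixes — blocks pairwise distinct and different from the peeled block `c`, link matrices over `ℂ`,
labels the chart images `Φ_c(P_{c'})`. This file re-runs the induction against exactly that family:

* `chainVal_eq_zero_of_bind₁_kiPer_ro` — **FULL WIDTH 2 ⟸ `ZperHitsRO(m)`** (KERNEL): if no pushed read-once
  chart chain computes a nonzero multiple of `per_m(Y)` (hypothesis `hZro`), then `φ = bind₁ (kiPer m)` annihilates
  no nonzero width-2 read-once block chain (distinct blocks, any order, any length, arbitrary univariate links);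
* `kiPer_hits_isROABP_two_ro` — the same in the currency of `KIPlantedHittingRO` (`w = 2`, every `d`, `π`, `N`);
* `zperHitsRO_iff` — the leaf read intrinsically (no `K`-chains): «for every read-once block chain `rest` and every
  block `c` it does not read, if `Φ_c(φ(value of rest))` is a multiple of `per_m(Y) = Φ_c(P_c)` then `φ(value) = 0`»,
  i.e. FRESH-CHART NON-DIVISIBILITY of `φ`-images of complex width-2 read-once chains.

HONEST STATUS: `ZperHitsRO(m)` is NOT decided here for any `m`; the SSS void is not a pushed chart chain (it
reads each variable at least `(m-1)!` times, through links `diag(Y,1)`, `diag(1,Y)`, which are not of the form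
`M(Φ_c(P_{c'}))`, `M ∈ ℂ[X]^{2×2}`), so [SahaSaptharishiSaxena2009] does not bear on it; the `m = 2` failure
`zperHits_two_fails` used the labels `y₀₀y₁₁`, `y₀₁y₁₀`, which are not chart images either. Transfer / conditional
decision only: 0 S-currency; rung 0; `VP ≠ VNP` untouched. [cite: SahaSaptharishiSaxena2009, Lemma 2.1]
-/

open MvPolynomial Finset
open Literature.Computability.AlgebraicComplexity Literature.Computability.MetaComplexity

namespace Summit.ValiantsHypothesis.ValiantsHypothesis.Theorems.DefinabilityGapZperTransferRO

open DefinabilityGapAffineRung DefinabilityGapAxisSubstitution DefinabilityGapZeroedBlocks DefinabilityGapZperTransfer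

noncomputable section

variable {m : ℕ}

/-- **THE REPAIRED `Z(per)` TRANSFER** (KERNEL): if `Z(per_m)` hits the PUSHED READ-ONCE CHART CHAINS — the chains
`pushLinks m c rest` of a read-once block suffix `rest` (blocks pairwise distinct) not reading the block `c`, with
boundary vectors from `ℂ` — up to multiples (the leaf `ZperHitsRO(m)`, hypothesis `hZro`), then `φ = bind₁ (kiPer m)`
annihilates no nonzero width-2 read-once block chain. Same induction as `chainVal_eq_zero_of_bind₁_kiPer` (head-link
expansion, chart, peeling powers of `per_m`), with the leaf applied only where the induction needs it. [this file] -/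
theorem chainVal_eq_zero_of_bind₁_kiPer_ro
    (hZro : ∀ (c : Fin 3 → Fin (qOf m)) (rest : List (W2Link m)),
      (rest.map W2Link.blk).Nodup → c ∉ rest.map W2Link.blk →
      ∀ (u v : Fin 2 → ℂ) (H : MvPolynomial (Fin m × Fin m) (Kfrac m)),
        chainVal ((pushLinks m c rest).map ulink) (fun i => toKfrac m (u i)) (fun k => toKfrac m (v k)) =
            perPoly (Fin m) (Kfrac m) * H →
          chainVal ((pushLinks m c rest).map ulink) (fun i => toKfrac m (u i)) (fun k => toKfrac m (v k)) = 0) :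
    ∀ l : List (W2Link m), (l.map W2Link.blk).Nodup → ∀ u v : Fin 2 → ℂ,
      bind₁ (kiPer m) (chainVal (l.map W2Link.mat) u v) = 0 → chainVal (l.map W2Link.mat) u v = 0 := by
  intro l
  induction l with
  | nil =>
    intro _ u v h
    rw [List.map_nil, chainVal_nil] at h ⊢
    rw [bind₁_C_right, C_eq_zero] at h
    exact C_eq_zero.2 h
  | cons L rest ih =>
    intro hnd u v h
    rw [List.map_cons, List.nodup_cons] at hnd
    obtain ⟨n, hn⟩ : ∃ n : ℕ, ∀ i k, (L.M i k).natDegree < n :=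
      ⟨(Finset.univ.sup fun ik : Fin 2 × Fin 2 => (L.M ik.1 ik.2).natDegree) + 1, fun i k =>
        Nat.lt_succ_of_le (Finset.le_sup (f := fun ik : Fin 2 × Fin 2 => (L.M ik.1 ik.2).natDegree)
          (Finset.mem_univ (i, k)))⟩
    have hexp : chainVal ((L :: rest).map W2Link.mat) u v =
        ∑ t ∈ Finset.range n, X L.blk ^ t * chainVal (rest.map W2Link.mat) (coeffVec L.M u t) v :=
      chainVal_cons_ulink L.M (X L.blk) (rest.map W2Link.mat) u v hn
    rw [hexp] at h ⊢
    have hGt : ∀ t < n,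
        chart m L.blk (bind₁ (kiPer m) (chainVal (rest.map W2Link.mat) (coeffVec L.M u t) v)) = 0 := by
      have h2 := congrArg (chart m L.blk) h
      rw [map_sum, map_sum, map_zero] at h2
      simp only [map_mul, map_pow, bind₁_X_right, chart_kiPer_self] at h2
      refine eq_zero_of_sum_pow_mul (perPoly_ne_zero (Fin m) (Kfrac m)) n
        (fun t => chart m L.blk (bind₁ (kiPer m) (chainVal (rest.map W2Link.mat) (coeffVec L.M u t) v)))
        (fun t H hH => ?_) h2
      beta_reduce at hH ⊢
      rw [chart_bind₁_chainVal] at hH ⊢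
      exact hZro L.blk rest hnd.2 hnd.1 _ _ H hH
    refine Finset.sum_eq_zero fun t ht => ?_
    have hb : bind₁ (kiPer m) (chainVal (rest.map W2Link.mat) (coeffVec L.M u t) v) = 0 :=
      chart_injective L.blk (by rw [hGt t (Finset.mem_range.1 ht), map_zero])
    rw [ih hnd.2 _ v hb, mul_zero]

/-- **FULL WIDTH 2 OF THE READ-ONCE LEAF FROM `ZperHitsRO(m)`**, in the currency of `KIPlantedHittingRO` (`w = 2`,
every degree `d`, every variable order `π`, every length `N`). [this file] -/
theorem kiPer_hits_isROABP_two_ro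
    (hZro : ∀ (c : Fin 3 → Fin (qOf m)) (rest : List (W2Link m)),
      (rest.map W2Link.blk).Nodup → c ∉ rest.map W2Link.blk →
      ∀ (u v : Fin 2 → ℂ) (H : MvPolynomial (Fin m × Fin m) (Kfrac m)),
        chainVal ((pushLinks m c rest).map ulink) (fun i => toKfrac m (u i)) (fun k => toKfrac m (v k)) =
            perPoly (Fin m) (Kfrac m) * H →
          chainVal ((pushLinks m c rest).map ulink) (fun i => toKfrac m (u i)) (fun k => toKfrac m (v k)) = 0)
    {N d : ℕ} (π : Fin N ≃ (Fin 3 → Fin (qOf m))) (D : MvPolynomial (Fin 3 → Fin (qOf m)) ℂ) (hD : D ≠ 0)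
    (hR : IsROABP ℂ 2 d π D) : bind₁ (kiPer m) D ≠ 0 := by
  obtain ⟨hw, M, hM, hDM⟩ := hR
  choose p hp using hM
  let lk : Fin N → W2Link m := fun i => ⟨π i, Matrix.of fun a b => p i a b⟩
  have hmat : ∀ i, (lk i).mat = M i := fun i => by
    refine Matrix.ext fun a b => ?_
    simp only [W2Link.mat, ulink, Matrix.map_apply, Matrix.of_apply, lk]
    exact (hp i a b).2.symm
  have hl : (List.ofFn lk).map W2Link.mat = List.ofFn M := by
    rw [List.map_ofFn]
    exact congrArg List.ofFn (funext hmat)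
  have hnd : ((List.ofFn lk).map W2Link.blk).Nodup := by
    rw [List.map_ofFn]
    exact List.nodup_ofFn_ofInjective π.injective
  have hDval : D = chainVal ((List.ofFn lk).map W2Link.mat) ![1, 0] ![1, 0] := by
    rw [hl, hDM, chainVal]
    simp [Matrix.mulVec, dotProduct, Fin.sum_univ_two]
  intro h0
  apply hD
  rw [hDval] at h0 ⊢
  exact chainVal_eq_zero_of_bind₁_kiPer_ro hZro _ hnd _ _ h0

/-- **THE LEAF READ INTRINSICALLY** (no `K`-chains): `ZperHitsRO(m)` says that for every read-once block chain `rest`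
and every block `c` it does not read, `Φ_c(φ(value of rest))` is a multiple of `per_m(Y) = Φ_c(P_c)` only if
`φ(value of rest) = 0` — fresh-chart non-divisibility of `φ`-images of complex width-2 read-once chains. [this file] -/
theorem zperHitsRO_iff :
    (∀ (c : Fin 3 → Fin (qOf m)) (rest : List (W2Link m)),
      (rest.map W2Link.blk).Nodup → c ∉ rest.map W2Link.blk →
      ∀ (u v : Fin 2 → ℂ) (H : MvPolynomial (Fin m × Fin m) (Kfrac m)),
        chainVal ((pushLinks m c rest).map ulink) (fun i => toKfrac m (u i)) (fun k => toKfrac m (v k)) =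
            perPoly (Fin m) (Kfrac m) * H →
          chainVal ((pushLinks m c rest).map ulink) (fun i => toKfrac m (u i)) (fun k => toKfrac m (v k)) = 0) ↔
    (∀ (c : Fin 3 → Fin (qOf m)) (rest : List (W2Link m)),
      (rest.map W2Link.blk).Nodup → c ∉ rest.map W2Link.blk →
      ∀ (u v : Fin 2 → ℂ) (H : MvPolynomial (Fin m × Fin m) (Kfrac m)),
        chart m c (bind₁ (kiPer m) (chainVal (rest.map W2Link.mat) u v)) = perPoly (Fin m) (Kfrac m) * H →
          bind₁ (kiPer m) (chainVal (rest.map W2Link.mat) u v) = 0) := by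
  refine ⟨fun h c rest hnd hc u v H hH => ?_, fun h c rest hnd hc u v H hH => ?_⟩
  · rw [chart_bind₁_chainVal] at hH
    exact chart_injective c (by rw [chart_bind₁_chainVal, h c rest hnd hc u v H hH, map_zero])
  · rw [← chart_bind₁_chainVal] at hH ⊢
    rw [h c rest hnd hc u v H hH, map_zero]

end

end Summit.ValiantsHypothesis.ValiantsHypothesis.Theorems.DefinabilityGapZperTransferRO
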